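import Literature.NumberTheory.Automorphic.ArchCartanCoordinates
import HarnessLib

/-!
# Shelstad's normaliser `R_T` and the half-sum twist on the Cartan coordinates of `H_∞` and `G′_∞` — GROUP-FREE
# (Shelstad 1979 §4 p. 22–25; Bouaziz 1994 §3.1 p. 579, §6.2 p. 591; Rogawski 1990 §8.2 p. 122)

Topic `NumberTheory/Automorphic`; namespace `Literature.NumberTheory.Automorphic.ArchCartan`.  Definitions WITH BODIES and theorems only (no instance, no notation,
no axiom, no named fact, no `sorry`).  Cell `pub/hodgecm-mathlib`, line LH3 (closer stub `stub_N9`, crux H413 = `stmt-HodgeConjecture-24833`); organ **(COORD)**, second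
half (LH3-plan (g2) DEALER WORDS #7; D2-SPEC v1 §1 ∕ §3 ∕ §6 (a), D2′-SPEC v1 §1).  Over the coordinates of ★ `ArchCartanCoordinates` (`c : W → Fin 3 → ℝ`, split places
`S : Finset W`; compact place: angles `θ₀ = c w 0`, `θ₂ = c w 2` of the 2-block, `θ₁ = c w 1`; split place: `x = c w 0`, compact-line angle `c w 1`, pair phase `θ = c w 2`):
* `archRH S c` — Shelstad's `R_T` [Shelstad1979, §4 p. 22] for the `H`-Cartan of type `S` (= Bouaziz's `b_Ψ |D_H|^{1∕2}` [Bouaziz1994IntegralesOrbitales, §3.1 p. 579]):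
  the SIGNED imaginary factor `1 − ξ_{−α} = 1 − e^{i(θ₂−θ₀)}` at a compact place, `|e^{x} − e^{−x}|` at a split place; `archRG S′ c` — the same on `G′` (three signed factors
  `i < j` at a compact place; real root and complex pair by absolute value at a split place);
* `archERho S c = ∏_{w∉S} e^{i(θ₀−θ₂)∕2}` — the half-sum twist (Bouaziz's `r_Ψ`, Shelstad's `D̂`), `archERhoG` its `G′` twin.
SLOT TABLE (LH3-plan (g2) 05:26:18Z (s3), binding for the atlas ∕ D2 ∕ D2′): compact place — slots `(0, 2)` = the two angles of the 2-block ∕ of the even-sign pair, slot `1` = the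
ODD line (on `H`: the `U(Φ₁)`-block; on `G′` at an indefinite compact chart: the line whose sign differs — SIGN-ADAPTED order, the atlas absorbs the permutation; at a definite
place: whichever line the atlas fixes, no wall is noncompact there); split place — slot `0 = x`, slot `1` = odd-line angle, slot `2 = θ`.  Wall points are quantified with
`c w 0 = c w 2` only (D2-SPEC v2 ruling F2), where `cayPt`'s mean phase `(c w 0 + c w 2)∕2` IS `c w 0` (`cayPt_eq_update_of_wall` below, LHref-N (s5)).
LEMMAS: smoothness of the coordinate moves `flipAt ∕ negXAt ∕ cayPt ∕ ν ↦ c + ν • nrm w` (§1); non-vanishing on `RegS ∕ RegG`; `‖archRH S c‖² = ∏ (…)` in the shape of ★ `archWeylDiscr_archDiagTorus` at `N = 2` (so that (T-ATLAS) proves `‖R‖² = |D_H(endoTorus S c)|_∞`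
in one line); `archERho · archRH = ∏_{w∉S} 2i sin((θ₀−θ₂)∕2) · ∏_{w∈S} |e^x − e^{−x}|` (print's and (C-bdry)'s `2 sin ψ`); periodicity of `archRH` and the `(−1)^k` NON-periodicity
of `archERho`; the flip character `archRH S (flipAt w c) = −e^{i(θ₀−θ₂)} archRH S c` and evenness under `x ↦ −x`; THE WALL LEMMA
`archERho S c = (−1)^k · archERho (insert w S) c` on the wall component `θ₀ − θ₂ = 2πk` (the sign the jump constants `jc S w k` of D2-SPEC §3 absorb); `archRH (insert w S) (cayPt w c) = 0`
(the Cayley point is a real wall point of the split chart).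
HONEST LABEL: HC_CM is proved only modulo the 7 printed citations (2 remaining: hLiu418 = stmt-HodgeConjecture-24832, h413 = stmt-HodgeConjecture-24833) until rung 0 closes;
coordinate bookkeeping, pays nothing by itself.

## References
* [Shelstad1979] D. Shelstad, *Characters and inner forms of a quasi-split group over ℝ*, Compositio Math. 39 (1979), §4 pp. 22–25 (`R_T`, `D̂`, (II), the Cayley data).
* [Bouaziz1994IntegralesOrbitales] A. Bouaziz, *Intégrales orbitales sur les groupes de Lie réductifs*, Ann. Sci. ÉNS 27 (1994) 573–609, §3.1 p. 579 (`b_Ψ`), §6.2 p. 591 (`r_Ψ`).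
* [Rogawski1990] J. D. Rogawski, *Automorphic Representations of Unitary Groups in Three Variables*, Ann. of Math. Stud. 123 (1990), §8.2 p. 122 (`2 sin ψ`), §14.2 p. 232 (`|D|`).
-/

set_option autoImplicit false

noncomputable section

open Complex Set Function Real

namespace Literature.NumberTheory.Automorphic.ArchCartan

variable {W : Type*}

/-! ## §1 The Cayley point on the `k = 0` walls; smoothness of the coordinate moves (affine maps) -/

section Smooth

variable [Fintype W] [DecidableEq W]

omit [Fintype W] in
/-- On the wall component `θ₀ = θ₂` (the only one D2-SPEC v2 quantifies over, ruling F2) the Cayley point's mean phase IS `θ₀`: `cayPt w c = update c w (0, c w 1, c w 0)` —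
LHref-N's spelling (s5); on the other components `θ₀ − θ₂ = 2πk` the two differ by the antipodal sign `(−1)^k`, which is why walls are quantified at `k = 0` and reached
by periodicity. [cite: Shelstad1979, §4 p. 25] -/
theorem cayPt_eq_update_of_wall {w : W} {c : W → Fin 3 → ℝ} (h : c w 0 = c w 2) : cayPt w c = Function.update c w ![0, c w 1, c w 0] := by
  rw [cayPt, ← h, add_self_div_two]

/-- Every coordinate move of §2 is smooth (they are affine): `flipAt`. [cite: Shelstad1979, §4 p. 23] -/
theorem contDiff_flipAt (w : W) : ContDiff ℝ ((⊤ : ℕ∞) : WithTop ℕ∞) (flipAt w : (W → Fin 3 → ℝ) → W → Fin 3 → ℝ) := by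
  refine contDiff_pi.2 fun w' => contDiff_pi.2 fun j => ?_
  by_cases hw : w' = w
  · subst hw
    simp only [flipAt_apply_self]
    fin_cases j
    · exact contDiff_apply_apply ℝ ℝ w' 2
    · exact contDiff_apply_apply ℝ ℝ w' 1
    · exact contDiff_apply_apply ℝ ℝ w' 0
  · simp only [flipAt_apply_of_ne hw]
    exact contDiff_apply_apply ℝ ℝ w' j

/-- `negXAt` is smooth. [cite: Shelstad1979, §4 p. 23] -/
theorem contDiff_negXAt (w : W) : ContDiff ℝ ((⊤ : ℕ∞) : WithTop ℕ∞) (negXAt w : (W → Fin 3 → ℝ) → W → Fin 3 → ℝ) := by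
  refine contDiff_pi.2 fun w' => contDiff_pi.2 fun j => ?_
  by_cases hw : w' = w
  · subst hw
    simp only [negXAt_apply_self]
    fin_cases j
    · exact (contDiff_apply_apply ℝ ℝ w' 0).neg
    · exact contDiff_apply_apply ℝ ℝ w' 1
    · exact contDiff_apply_apply ℝ ℝ w' 2
  · simp only [negXAt_apply_of_ne hw]
    exact contDiff_apply_apply ℝ ℝ w' j

/-- `cayPt` is smooth. [cite: Shelstad1979, §4 p. 25] -/
theorem contDiff_cayPt (w : W) : ContDiff ℝ ((⊤ : ℕ∞) : WithTop ℕ∞) (cayPt w : (W → Fin 3 → ℝ) → W → Fin 3 → ℝ) := by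
  refine contDiff_pi.2 fun w' => contDiff_pi.2 fun j => ?_
  by_cases hw : w' = w
  · subst hw
    simp only [cayPt_apply_self]
    fin_cases j
    · exact contDiff_const
    · exact contDiff_apply_apply ℝ ℝ w' 1
    · exact ((contDiff_apply_apply ℝ ℝ w' 0).add (contDiff_apply_apply ℝ ℝ w' 2)).div_const _
  · simp only [cayPt_apply_of_ne hw]
    exact contDiff_apply_apply ℝ ℝ w' j

/-- The normal curve `ν ↦ c + ν • nrm w` is smooth (affine). [cite: Rogawski1990, §8.2 p. 122] -/
theorem contDiff_add_smul_nrm (c : W → Fin 3 → ℝ) (w : W) : ContDiff ℝ ((⊤ : ℕ∞) : WithTop ℕ∞) fun ν : ℝ => c + ν • nrm w :=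
  contDiff_const.add (contDiff_id.smul contDiff_const)

end Smooth

/-! ## §2 The normalisers `R_T` and the half-sum twists -/

section Normalisers

variable [Fintype W] [DecidableEq W]

/-- **`archRH S c` — Shelstad's `R_T` for the `H`-Cartan of type `S`** (one root pair per place): at a compact place the SIGNED imaginary factor `1 − ξ_{−α} = 1 − e^{i(θ₂ − θ₀)}`,
at a split place the real-root factor `|e^{x} − e^{−x}| = |D|^{1∕2}`.  (= Bouaziz's `b_Ψ |D_H|^{1∕2}`, `Ψ` = the imaginary roots; the `U(Φ₁)`-block has no roots.)
[cite: Shelstad1979, §4 p. 22] [cite: Bouaziz1994IntegralesOrbitales, §3.1 p. 579] -/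
def archRH (S : Finset W) (c : W → Fin 3 → ℝ) : ℂ :=
  ∏ w, if w ∈ S then ((|Real.exp (c w 0) - Real.exp (-c w 0)| : ℝ) : ℂ) else 1 - (Circle.exp (c w 2 - c w 0) : ℂ)

/-- **`archRG S′ c` — Shelstad's `R_T` for the `G′`-Cartan of type `S′`**: at a compact place the three SIGNED imaginary factors `1 − e^{i(θ_j − θ_i)}`, `i < j`; at a split place
(eigenvalues `e^{±x+iθ}`, `e^{iφ}` with `x, φ, θ = c w 0, c w 1, c w 2`) the absolute values over the real root and the complex pair:
`|e^{x} − e^{−x}| · |e^{x+iθ} − e^{iφ}| · |e^{−x+iθ} − e^{iφ}|` (the `|λ_iλ_j|` denominators of `|D|` cancel: `|e^{x+iθ}e^{−x+iθ}| = 1`, `|e^{±x+iθ}e^{iφ}| = e^{±x}`).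
[cite: Shelstad1979, §4 p. 22] [cite: Rogawski1990, §8.2 p. 118] -/
def archRG (S' : Finset W) (c : W → Fin 3 → ℝ) : ℂ :=
  ∏ w, if w ∈ S' then
      ((|Real.exp (c w 0) - Real.exp (-c w 0)| *
          ‖Complex.exp (c w 0 + c w 2 * I) - Complex.exp (c w 1 * I)‖ * ‖Complex.exp (-c w 0 + c w 2 * I) - Complex.exp (c w 1 * I)‖ : ℝ) : ℂ)
    else (1 - (Circle.exp (c w 1 - c w 0) : ℂ)) * (1 - (Circle.exp (c w 2 - c w 0) : ℂ)) * (1 - (Circle.exp (c w 2 - c w 1) : ℂ))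

/-- **`archERho S c` — the half-sum twist `e^{ρ_Ψ}` on the `H`-Cartan of type `S`**: `∏_{w ∉ S} e^{i(θ₀ − θ₂)∕2}` (Bouaziz's `r_Ψ`, Shelstad's `D̂ = e^{−ρ} ∘ D ∘ e^{ρ}`); a unit, NOT
`2π`-periodic (it changes by `(−1)^k`). [cite: Bouaziz1994IntegralesOrbitales, §6.2 p. 591] [cite: Shelstad1979, §4 p. 24] -/
def archERho (S : Finset W) (c : W → Fin 3 → ℝ) : ℂ :=
  ∏ w, if w ∈ S then 1 else (Circle.exp ((c w 0 - c w 2) / 2) : ℂ)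

/-- **`archERhoG S′ c` — the half-sum twist on the `G′`-Cartan of type `S′`**: at a compact place the half sum of the three positive roots `i < j` is `θ₀ − θ₂`; at a split place
there are no imaginary roots. [cite: Shelstad1979, §4 p. 24] [cite: Bouaziz1994IntegralesOrbitales, §6.2 p. 591] -/
def archERhoG (S' : Finset W) (c : W → Fin 3 → ℝ) : ℂ :=
  ∏ w, if w ∈ S' then 1 else (Circle.exp (c w 0 - c w 2) : ℂ)

/-- `1 − e^{i(b − a)} ≠ 0` iff `e^{ia} ≠ e^{ib}`. [cite: Shelstad1979, §4 p. 22] -/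
theorem one_sub_coe_circleExp_sub_ne_zero_iff (a b : ℝ) : (1 : ℂ) - (Circle.exp (b - a) : ℂ) ≠ 0 ↔ Circle.exp a ≠ Circle.exp b := by
  rw [sub_ne_zero, ne_comm, not_iff_not]
  constructor
  · intro h
    have h1 : Circle.exp (b - a) = 1 := Circle.ext (by rw [h, Circle.coe_one])
    have h2 : Circle.exp b = Circle.exp (b - a) * Circle.exp a := by rw [← Circle.exp_add, sub_add_cancel]
    rw [h2, h1, one_mul]
  · intro h
    rw [show b - a = b + -a by ring, Circle.exp_add, Circle.exp_neg, ← h, mul_inv_cancel, Circle.coe_one]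

/-- `|e^{x} − e^{−x}| ≠ 0` iff `x ≠ 0`. [cite: Shelstad1979, §4 p. 22] -/
theorem abs_exp_sub_exp_neg_ne_zero_iff (x : ℝ) : |Real.exp x - Real.exp (-x)| ≠ 0 ↔ x ≠ 0 := by
  rw [abs_ne_zero, sub_ne_zero, Ne, Real.exp_eq_exp, not_iff_not]
  constructor
  · intro h; linarith
  · intro h; rw [h, neg_zero]

/-- **`R_T ≠ 0` on the regular set** (`H` side). [cite: Shelstad1979, §4 p. 22] [cite: Bouaziz1994IntegralesOrbitales, §3.1 p. 579] -/
theorem archRH_ne_zero_of_mem_regS {S : Finset W} {c : W → Fin 3 → ℝ} (hc : c ∈ RegS S) : archRH S c ≠ 0 := by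
  refine Finset.prod_ne_zero_iff.2 fun w _ => ?_
  by_cases hw : w ∈ S
  · rw [if_pos hw, Complex.ofReal_ne_zero]
    exact (abs_exp_sub_exp_neg_ne_zero_iff _).2 (hc.2 w hw)
  · rw [if_neg hw]
    exact (one_sub_coe_circleExp_sub_ne_zero_iff _ _).2 (hc.1 w hw)

/-- At a split place with `x ≠ 0` the complex-root factors do not vanish: `|e^{±x+iθ}| = e^{±x} ≠ 1 = |e^{iφ}|`. [cite: Rogawski1990, §8.2 p. 118] -/
theorem norm_exp_add_mul_I_sub_exp_mul_I_ne_zero {x : ℝ} (hx : x ≠ 0) (θ φ : ℝ) :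
    ‖Complex.exp (x + θ * I) - Complex.exp (φ * I)‖ ≠ 0 := by
  rw [norm_ne_zero_iff, sub_ne_zero]
  intro h
  have h1 : ‖Complex.exp (x + θ * I)‖ = ‖Complex.exp (φ * I)‖ := by rw [h]
  rw [Complex.norm_exp, Complex.norm_exp, Complex.add_re, Complex.ofReal_re, Complex.re_ofReal_mul, Complex.re_ofReal_mul, Complex.I_re,
    mul_zero, mul_zero, add_zero, Real.exp_eq_exp] at h1
  exact hx h1

/-- **`R_T ≠ 0` on the regular set** (`G′` side). [cite: Shelstad1979, §4 p. 22] -/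
theorem archRG_ne_zero_of_mem_regG {S' : Finset W} {c : W → Fin 3 → ℝ} (hc : c ∈ RegG S') : archRG S' c ≠ 0 := by
  refine Finset.prod_ne_zero_iff.2 fun w _ => ?_
  by_cases hw : w ∈ S'
  · rw [if_pos hw, Complex.ofReal_ne_zero]
    have hx : c w 0 ≠ 0 := hc.2 w hw
    refine mul_ne_zero (mul_ne_zero ((abs_exp_sub_exp_neg_ne_zero_iff _).2 hx) (norm_exp_add_mul_I_sub_exp_mul_I_ne_zero hx _ _)) ?_
    have hx' : -c w 0 ≠ 0 := neg_ne_zero.2 hx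
    simpa only [Complex.ofReal_neg] using norm_exp_add_mul_I_sub_exp_mul_I_ne_zero hx' (c w 2) (c w 1)
  · rw [if_neg hw]
    have hinj := hc.1 w hw
    refine mul_ne_zero (mul_ne_zero ((one_sub_coe_circleExp_sub_ne_zero_iff _ _).2 fun h => ?_)
      ((one_sub_coe_circleExp_sub_ne_zero_iff _ _).2 fun h => ?_)) ((one_sub_coe_circleExp_sub_ne_zero_iff _ _).2 fun h => ?_)
    · exact absurd (hinj h) (by decide)
    · exact absurd (hinj h) (by decide)
    · exact absurd (hinj h) (by decide)

/-- `‖1 − e^{i(b−a)}‖ = ‖e^{ia} − e^{ib}‖`. [cite: Shelstad1979, §4 p. 22] -/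
theorem norm_one_sub_coe_circleExp_sub (a b : ℝ) : ‖(1 : ℂ) - (Circle.exp (b - a) : ℂ)‖ = ‖(Circle.exp a : ℂ) - Circle.exp b‖ := by
  have ha : (Circle.exp a : ℂ) ≠ 0 := Circle.coe_ne_zero _
  have h : (1 : ℂ) - (Circle.exp (b - a) : ℂ) = ((Circle.exp a : ℂ) - Circle.exp b) * (Circle.exp a : ℂ)⁻¹ := by
    rw [show b - a = b + -a by ring, Circle.exp_add, Circle.exp_neg, Circle.coe_mul, Circle.coe_inv, sub_mul, mul_inv_cancel₀ ha]
  rw [h, norm_mul, norm_inv, Circle.norm_coe, inv_one, mul_one]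

/-- **`‖R_T‖² = |D_H|_∞` IN COORDINATES** — the shape of ★ `archWeylDiscr_archDiagTorus` at `N = 2` (compact places: `‖e^{iθ₀} − e^{iθ₂}‖²`) and of the split eigenvalue gap
`(e^{x} − e^{−x})²`; (T-ATLAS) matches it with `archWeylDiscr` of the torus point. [cite: Shelstad1979, §4 p. 22] [cite: Rogawski1990, §14.2 p. 232] -/
theorem norm_sq_archRH (S : Finset W) (c : W → Fin 3 → ℝ) :
    ‖archRH S c‖ ^ 2 = ∏ w, if w ∈ S then (Real.exp (c w 0) - Real.exp (-c w 0)) ^ 2 else ‖(Circle.exp (c w 0) : ℂ) - Circle.exp (c w 2)‖ ^ 2 := by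
  rw [archRH, norm_prod, ← Finset.prod_pow]
  refine Finset.prod_congr rfl fun w _ => ?_
  by_cases hw : w ∈ S
  · rw [if_pos hw, if_pos hw, Complex.norm_real, Real.norm_eq_abs, abs_abs, sq_abs]
  · rw [if_neg hw, if_neg hw, norm_one_sub_coe_circleExp_sub]

/-- The twist is a unit: `‖archERho S c‖ = 1`. [cite: Bouaziz1994IntegralesOrbitales, §6.2 p. 591] -/
theorem norm_archERho (S : Finset W) (c : W → Fin 3 → ℝ) : ‖archERho S c‖ = 1 := by
  rw [archERho, norm_prod]
  refine Finset.prod_eq_one fun w _ => ?_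
  by_cases hw : w ∈ S
  · rw [if_pos hw, norm_one]
  · rw [if_neg hw, Circle.norm_coe]

/-- `archERho S c ≠ 0`. [cite: Bouaziz1994IntegralesOrbitales, §6.2 p. 591] -/
theorem archERho_ne_zero (S : Finset W) (c : W → Fin 3 → ℝ) : archERho S c ≠ 0 :=
  norm_ne_zero_iff.1 (by rw [norm_archERho]; exact one_ne_zero)

/-- `‖archERhoG S′ c‖ = 1`. [cite: Shelstad1979, §4 p. 24] -/
theorem norm_archERhoG (S' : Finset W) (c : W → Fin 3 → ℝ) : ‖archERhoG S' c‖ = 1 := by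
  rw [archERhoG, norm_prod]
  refine Finset.prod_eq_one fun w _ => ?_
  by_cases hw : w ∈ S'
  · rw [if_pos hw, norm_one]
  · rw [if_neg hw, Circle.norm_coe]

/-- `e^{ia} − e^{−ia} = 2i sin a` on `ℂ` for real `a`. [cite: Rogawski1990, §8.2 p. 122] -/
theorem coe_circleExp_sub_coe_circleExp_neg (a : ℝ) : (Circle.exp a : ℂ) - (Circle.exp (-a) : ℂ) = 2 * I * Real.sin a := by
  rw [Circle.coe_exp, Circle.coe_exp, Complex.ofReal_neg, neg_mul, ← Complex.two_sinh, Complex.sinh_mul_I, Complex.ofReal_sin]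
  ring

/-- **`e^{ρ} · R_T` is print's normaliser**: `archERho S c · archRH S c = ∏_{w ∉ S} 2i sin((θ₀ − θ₂)∕2) · ∏_{w ∈ S} |e^{x} − e^{−x}|` — at one moving place exactly the `2 sin ψ`
of (C-bdry) ∕ (J-nc) (up to the constant `i` and the frozen places). [cite: Rogawski1990, §8.2 p. 122] [cite: Shelstad1979, §4 p. 24] -/
theorem archERho_mul_archRH (S : Finset W) (c : W → Fin 3 → ℝ) :
    archERho S c * archRH S c = ∏ w, if w ∈ S then ((|Real.exp (c w 0) - Real.exp (-c w 0)| : ℝ) : ℂ) else 2 * I * Real.sin ((c w 0 - c w 2) / 2) := by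
  rw [archERho, archRH, ← Finset.prod_mul_distrib]
  refine Finset.prod_congr rfl fun w _ => ?_
  by_cases hw : w ∈ S
  · rw [if_pos hw, if_pos hw, if_pos hw, one_mul]
  · rw [if_neg hw, if_neg hw, if_neg hw, mul_sub, mul_one, ← Circle.coe_mul, ← Circle.exp_add,
      show (c w 0 - c w 2) / 2 + (c w 2 - c w 0) = -((c w 0 - c w 2) / 2) by ring]
    exact coe_circleExp_sub_coe_circleExp_neg _

/-- `archRH` is `2π`-periodic in the angles (`w ∉ S` or `i ≠ 0`; the split coordinate `x` is not an angle). [cite: Shelstad1979, §4 p. 22] -/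
theorem archRH_add_angleShift (S : Finset W) (c : W → Fin 3 → ℝ) {w : W} {i : Fin 3} (h : w ∉ S ∨ i ≠ 0) (k : ℤ) :
    archRH S (c + angleShift w i k) = archRH S c := by
  unfold archRH
  refine Finset.prod_congr rfl fun w' _ => ?_
  by_cases hw' : w' ∈ S
  · rw [if_pos hw', if_pos hw']
    have h0 : (c + angleShift w i k) w' 0 = c w' 0 := by
      rw [Pi.add_apply, Pi.add_apply]
      by_cases hw : w' = w
      · subst hw
        rcases h with h | h
        · exact absurd hw' h
        · rw [angleShift_apply_self_of_ne w' h.symm, add_zero]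
      · rw [angleShift_apply_of_ne hw, Pi.zero_apply, add_zero]
    rw [h0]
  · rw [if_neg hw', if_neg hw']
    have h2 : Circle.exp ((c + angleShift w i k) w' 2 - (c + angleShift w i k) w' 0) = Circle.exp (c w' 2 - c w' 0) := by
      rw [sub_eq_add_neg, sub_eq_add_neg, Circle.exp_add, Circle.exp_add, Circle.exp_neg, Circle.exp_neg, circleExp_add_angleShift,
        circleExp_add_angleShift]
    rw [h2]

/-- `e^{i(a + 2πk)∕2} = (−1)^k e^{ia∕2}`: the half-angle twist changes sign on the odd sheets. [cite: Bouaziz1994IntegralesOrbitales, §6.2 p. 591] -/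
theorem coe_circleExp_half_add_two_pi_mul (a : ℝ) (k : ℤ) :
    (Circle.exp ((a + 2 * π * k) / 2) : ℂ) = (-1) ^ k * (Circle.exp (a / 2) : ℂ) := by
  rw [show (a + 2 * π * k) / 2 = a / 2 + k * π by ring, Circle.exp_add, Circle.coe_mul, mul_comm, Circle.coe_exp,
    show ((k * π : ℝ) : ℂ) * I = (k : ℂ) * (π * I) by push_cast; ring, Complex.exp_int_mul, Complex.exp_pi_mul_I]

/-- **The twist is NOT periodic**: shifting `θ₀` at a compact place by `2πk` multiplies `archERho` by `(−1)^k` (the source of the `k`-dependence of the jump constants in angle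
coordinates). [cite: Bouaziz1994IntegralesOrbitales, §6.2 p. 591] [cite: Shelstad1979, §4 p. 24] -/
theorem archERho_add_angleShift_zero (S : Finset W) (c : W → Fin 3 → ℝ) {w : W} (hw : w ∉ S) (k : ℤ) :
    archERho S (c + angleShift w 0 k) = (-1) ^ k * archERho S c := by
  unfold archERho
  rw [← Finset.mul_prod_erase Finset.univ _ (Finset.mem_univ w), ← Finset.mul_prod_erase Finset.univ (fun w' => if w' ∈ S then (1 : ℂ) else _) (Finset.mem_univ w),
    if_neg hw, if_neg hw, ← mul_assoc]
  congr 1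
  · rw [Pi.add_apply, Pi.add_apply, Pi.add_apply, angleShift_apply_self, angleShift_apply_self_of_ne w (show (2 : Fin 3) ≠ 0 by decide), add_zero,
      show (c w 0 + 2 * π * k - c w 2) / 2 = ((c w 0 - c w 2) + 2 * π * k) / 2 by ring, coe_circleExp_half_add_two_pi_mul]
  · refine Finset.prod_congr rfl fun w' hw' => ?_
    have hne : w' ≠ w := Finset.ne_of_mem_erase hw'
    simp only [Pi.add_apply, angleShift_apply_of_ne hne, Pi.zero_apply, add_zero]

/-- Shifting `θ₂` at a compact place by `2πk` also multiplies `archERho` by `(−1)^k` (`(−1)^{−k} = (−1)^k`). [cite: Bouaziz1994IntegralesOrbitales, §6.2 p. 591] -/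
theorem archERho_add_angleShift_two (S : Finset W) (c : W → Fin 3 → ℝ) {w : W} (hw : w ∉ S) (k : ℤ) :
    archERho S (c + angleShift w 2 k) = (-1) ^ k * archERho S c := by
  unfold archERho
  rw [← Finset.mul_prod_erase Finset.univ _ (Finset.mem_univ w), ← Finset.mul_prod_erase Finset.univ (fun w' => if w' ∈ S then (1 : ℂ) else _) (Finset.mem_univ w),
    if_neg hw, if_neg hw, ← mul_assoc]
  congr 1
  · rw [Pi.add_apply, Pi.add_apply, Pi.add_apply, angleShift_apply_self, angleShift_apply_self_of_ne w (show (0 : Fin 3) ≠ 2 by decide), add_zero,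
      show (c w 0 - (c w 2 + 2 * π * k)) / 2 = ((c w 0 - c w 2) + 2 * π * (-k : ℤ)) / 2 by push_cast; ring, coe_circleExp_half_add_two_pi_mul,
      zpow_neg, ← inv_zpow, inv_neg, inv_one]
  · refine Finset.prod_congr rfl fun w' hw' => ?_
    have hne : w' ≠ w := Finset.ne_of_mem_erase hw'
    simp only [Pi.add_apply, angleShift_apply_of_ne hne, Pi.zero_apply, add_zero]

/-- The remaining shifts (the `U(Φ₁)`-angle `i = 1`, or any coordinate at a split place) do not change `archERho`. [cite: Bouaziz1994IntegralesOrbitales, §6.2 p. 591] -/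
theorem archERho_add_angleShift_of_ne (S : Finset W) (c : W → Fin 3 → ℝ) {w : W} {i : Fin 3} (h : w ∈ S ∨ i = 1) (k : ℤ) :
    archERho S (c + angleShift w i k) = archERho S c := by
  unfold archERho
  refine Finset.prod_congr rfl fun w' _ => ?_
  by_cases hw' : w' ∈ S
  · rw [if_pos hw', if_pos hw']
  · rw [if_neg hw', if_neg hw']
    by_cases hw : w' = w
    · subst hw
      rcases h with h | h
      · exact absurd h hw'
      · subst h
        simp only [Pi.add_apply, angleShift_apply_self_of_ne w' (show (0 : Fin 3) ≠ 1 by decide), angleShift_apply_self_of_ne w' (show (2 : Fin 3) ≠ 1 by decide), add_zero]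
    · simp only [Pi.add_apply, angleShift_apply_of_ne hw, Pi.zero_apply, add_zero]

/-- **THE WALL LEMMA**: on the wall component `θ₀ − θ₂ = 2πk` at a compact place `w ∉ S`, `archERho S c = (−1)^k · archERho (insert w S) c` — the twists of the two adjacent charts
differ by the sign `(−1)^k` there (the `(−1)^k` absorbed in the jump constant `jc S w k`). [cite: Shelstad1979, §4 p. 25] [cite: Bouaziz1994IntegralesOrbitales, §6.2 p. 591] -/
theorem archERho_eq_neg_one_zpow_mul_archERho_insert (S : Finset W) (c : W → Fin 3 → ℝ) {w : W} (hw : w ∉ S) {k : ℤ} (hk : c w 0 - c w 2 = 2 * π * k) :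
    archERho S c = (-1) ^ k * archERho (insert w S) c := by
  unfold archERho
  rw [← Finset.mul_prod_erase Finset.univ _ (Finset.mem_univ w),
    ← Finset.mul_prod_erase Finset.univ (fun w' => if w' ∈ insert w S then (1 : ℂ) else _) (Finset.mem_univ w), if_neg hw, if_pos (Finset.mem_insert_self w S), one_mul]
  congr 1
  · rw [hk, show (2 * π * k : ℝ) / 2 = (0 + 2 * π * k) / 2 by ring, coe_circleExp_half_add_two_pi_mul, zero_div, Circle.exp_zero, Circle.coe_one, mul_one]
  · refine Finset.prod_congr rfl fun w' hw' => ?_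
    have hne : w' ≠ w := Finset.ne_of_mem_erase hw'
    simp only [Finset.mem_insert, hne, false_or]

/-- `archERho (insert w S)` does not read the place `w`; in particular it takes the same value at `c` and at its Cayley point. [cite: Shelstad1979, §4 p. 25] -/
theorem archERho_insert_cayPt (S : Finset W) (w : W) (c : W → Fin 3 → ℝ) : archERho (insert w S) (cayPt w c) = archERho (insert w S) c := by
  unfold archERho
  refine Finset.prod_congr rfl fun w' _ => ?_
  by_cases hw' : w' ∈ insert w S
  · rw [if_pos hw', if_pos hw']
  · rw [if_neg hw', if_neg hw']
    have hne : w' ≠ w := fun h => hw' (h ▸ Finset.mem_insert_self w S)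
    rw [cayPt_apply_of_ne hne]

/-- `archRH (insert w S)` at the Cayley point reads `x_w = 0` there: the real-root factor vanishes, so `archRH (insert w S) (cayPt w c) = 0` — the Cayley point is a (real) WALL point of
the split chart; jump data are read through the `InRegS`-extension, never through `R_T` itself. [cite: Shelstad1979, §4 p. 25] -/
theorem archRH_insert_cayPt (S : Finset W) (w : W) (c : W → Fin 3 → ℝ) : archRH (insert w S) (cayPt w c) = 0 := by
  unfold archRH
  refine Finset.prod_eq_zero (Finset.mem_univ w) ?_
  rw [if_pos (Finset.mem_insert_self w S), cayPt_apply_self_zero, neg_zero, sub_self, abs_zero, Complex.ofReal_zero]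

/-- `R_T` is EVEN under `x ↦ −x` at a split place (`|e^{−x} − e^{x}| = |e^{x} − e^{−x}|`): the realised real reflection does not twist the normalised family.
[cite: Shelstad1979, §4 p. 23] -/
theorem archRH_negXAt (S : Finset W) {w : W} (hw : w ∈ S) (c : W → Fin 3 → ℝ) : archRH S (negXAt w c) = archRH S c := by
  unfold archRH
  refine Finset.prod_congr rfl fun w' _ => ?_
  by_cases h : w' = w
  · subst h
    rw [if_pos hw, if_pos hw, negXAt_apply_self]
    simp only [Matrix.cons_val_zero, neg_neg]
    rw [abs_sub_comm]
  · rw [negXAt_apply_of_ne h]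

/-- `R_T` under the FLIP at a compact place: `archRH S (flipAt w c) = −e^{i(θ₀−θ₂)} · archRH S c` — a smooth unit, the character `det(ω) ξ_{ι−ω⁻¹ι}` of Shelstad's (II) for the
non-realised reflection. [cite: Shelstad1979, §4 p. 23] -/
theorem archRH_flipAt (S : Finset W) {w : W} (hw : w ∉ S) (c : W → Fin 3 → ℝ) :
    archRH S (flipAt w c) = -(Circle.exp (c w 0 - c w 2) : ℂ) * archRH S c := by
  unfold archRH
  rw [← Finset.mul_prod_erase Finset.univ _ (Finset.mem_univ w), ← Finset.mul_prod_erase Finset.univ (fun w' => if w' ∈ S then _ else _) (Finset.mem_univ w),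
    if_neg hw, if_neg hw, ← mul_assoc]
  congr 1
  · rw [flipAt_apply_self]
    simp only [Matrix.cons_val_zero, Matrix.cons_val_two, Matrix.tail_cons, Matrix.head_cons]
    have hu : (Circle.exp (c w 0 - c w 2) : ℂ) * (Circle.exp (c w 2 - c w 0) : ℂ) = 1 := by
      rw [← Circle.coe_mul, ← Circle.exp_add, show c w 0 - c w 2 + (c w 2 - c w 0) = 0 by ring, Circle.exp_zero, Circle.coe_one]
    linear_combination -hu
  · refine Finset.prod_congr rfl fun w' hw' => ?_
    rw [flipAt_apply_of_ne (Finset.ne_of_mem_erase hw')]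

end Normalisers

end Literature.NumberTheory.Automorphic.ArchCartan

end
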